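import Summits.Schanuel.Schanuel.Theorems.RoyCriterionSchanuelTwoStubLogRichSector
import Summits.Schanuel.Schanuel.Theorems.RoyCriterionSchanuelTwoStubGridRichSector
import Summits.Schanuel.Schanuel.Theorems.RoyCriterionRoyThesisTypedPointwise
import Summits.Schanuel.Schanuel.Theorems.RoyCriterionRoyThesisTypedRankThreeCMGamma
import Summits.Schanuel.Schanuel.Theorems.RoyCriterionRoyThesisTypedLemniscateTriple
import Literature.Barriers.Schanuel.LargeTranscendenceDegreeTwoTwoProofs

/-!
# Crux triage r2, triager 1 — crux `stmt-Schanuel-0463` (`RoyThesisTyped`)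

Kernel evidence for the two verdicts in `TRIAGE-r2-1.md`: the First lemmas of BOTH round-2 cards
are ≤ 40-line corollaries of theorems ALREADY LANDED under `Summits/Schanuel/Schanuel/Theorems/`
(no new transcendence input, no sorry):

* card `frequency-companion-sector` — `two_le_trdeg_of_bwCompanion` (its First lemma, verbatim
  signature) from the landed `SchanuelTwo` stub `Summit.Schanuel.Schanuel.Theorems.stub_logRichSector`
  (crux stmt-Schanuel-0069, line `CardA_BW`, file `RoyCriterionSchanuelTwoStubLogRichSector.lean`),
  and its crux-format corollary `royCriterionAt_of_bwCompanion` through the landed pointwise transfer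
  `RoyThesisTyped.le_trdeg_of_royHypothesis` (`RoyCriterionRoyThesisTypedPointwise.lean`, p95942);
  then the card's twisted-Baker-plane family `two_le_trdeg_twist` and its named instance
  `(−π², πi log 2)` (`two_le_trdeg_piI_twist_piI_logTwo`), and `two_le_trdeg_of_grid` (rank 2) =
  the landed `stub_gridRichSector` by `exact`;
* card `cm-tau-companion-rank-three` — its First-lemma block is landed verbatim
  (`RoyCriterionRoyThesisTypedRankThreeCMGamma.lean` p96389, `…LemniscateTriple.lean` p102129,
  `…Pointwise.lean` p95942/p100660): the `example`s below close by `exact`.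

§3 prints the axioms of the engines both cards lean on ((v) Leans-on check).
-/

set_option linter.dupNamespace false

noncomputable section

open Complex IntermediateField
open Literature.NumberTheory.Transcendental

namespace Summit.Schanuel.Schanuel.Cruxes.RoyThesisTyped.TriageR2K1

/-! ### §1 Card `frequency-companion-sector`: First lemma from landed content -/

/-- `(1, z)` is `ℚ`-linearly independent when `z` is irrational. [folklore] -/
theorem linearIndependent_one_of_not_mem_range {z : ℂ} (hz : z ∉ Set.range (algebraMap ℚ ℂ)) :
    LinearIndependent ℚ ![(1 : ℂ), z] := by
  rw [LinearIndependent.pair_iff]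
  intro s t hst
  by_cases ht : t = 0
  · subst ht
    simp only [zero_smul, add_zero, Rat.smul_def, mul_one, Rat.cast_eq_zero] at hst
    exact ⟨hst, rfl⟩
  · exfalso
    apply hz
    refine ⟨-s / t, ?_⟩
    have ht' : (t : ℂ) ≠ 0 := by exact_mod_cast ht
    simp only [Rat.smul_def, mul_one] at hst
    simp only [eq_ratCast, Rat.cast_div, Rat.cast_neg]
    rw [div_eq_iff ht']
    linear_combination -hst

/-- **Card 1's First lemma `two_le_trdeg_of_bwCompanion`, verbatim signature, from the LANDED stub
`stub_logRichSector`** with `l_j = x₀ y_j`, `μ = x₀⁻¹`: `e^{l_j} ∈ ℚ̄`, `l_j, μ` algebraic over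
`K = ℚ(y, e^y)`, `e^{μ l_j} = e^{y_j} ∈ K`. [cite: BakerTNT1975, Ch. 12 Theorem 12.2] -/
theorem two_le_trdeg_of_bwCompanion (y : Fin 2 → ℂ) (hy : LinearIndependent ℚ y) (x₀ : ℂ)
    (hx₀ : x₀ ∉ Set.range (algebraMap ℚ ℂ))
    (halg : IsAlgebraic ↥(IntermediateField.adjoin ℚ (Set.range y ∪ Set.range (cexp ∘ y))) x₀)
    (h0 : IsAlgebraic ℚ (cexp (x₀ * y 0))) (h1 : IsAlgebraic ℚ (cexp (x₀ * y 1))) :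
    (2 : Cardinal) ≤ Algebra.trdeg ℚ
      ↥(IntermediateField.adjoin ℚ (Set.range y ∪ Set.range (cexp ∘ y))) := by
  set K : IntermediateField ℚ ℂ :=
    IntermediateField.adjoin ℚ (Set.range y ∪ Set.range (cexp ∘ y)) with hK
  have hx0 : x₀ ≠ 0 := by
    rintro rfl
    exact hx₀ ⟨0, by simp⟩
  have hyK : ∀ j, y j ∈ K := fun j => subset_adjoin ℚ _ (Or.inl ⟨j, rfl⟩)
  have heK : ∀ j, cexp (y j) ∈ K := fun j => subset_adjoin ℚ _ (Or.inr ⟨j, rfl⟩)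
  have hyalg : ∀ j, IsAlgebraic K (x₀ * y j) := fun j =>
    halg.mul (isAlgebraic_algebraMap (⟨y j, hyK j⟩ : K))
  have hli : LinearIndependent ℚ ![x₀ * y 0, x₀ * y 1] := by
    have hy2 : LinearIndependent ℚ ![y 0, y 1] := by
      convert hy using 1
      ext i
      fin_cases i <;> rfl
    rw [LinearIndependent.pair_iff] at hy2 ⊢
    intro s t hst
    apply hy2 s t
    have h' : x₀ * (s • y 0 + t • y 1) = 0 := by
      simp only [Rat.smul_def] at hst ⊢
      linear_combination hst
    exact (mul_eq_zero.1 h').resolve_left hx0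
  have hx₀inv : x₀⁻¹ ∉ Set.range (algebraMap ℚ ℂ) := by
    rintro ⟨q, hq⟩
    exact hx₀ ⟨q⁻¹, by rw [map_inv₀, hq, inv_inv]⟩
  have hirr : LinearIndependent ℚ ![(1 : ℂ), x₀⁻¹] :=
    linearIndependent_one_of_not_mem_range hx₀inv
  have hcancel : ∀ j, x₀⁻¹ * (x₀ * y j) = y j := fun j => by
    rw [← mul_assoc, inv_mul_cancel₀ hx0, one_mul]
  exact Summit.Schanuel.Schanuel.Theorems.stub_logRichSector y (x₀ * y 0) (x₀ * y 1) x₀⁻¹ h0 h1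
    hli hirr (hyalg 0) (hyalg 1) halg.inv
    (by rw [hcancel]; exact isAlgebraic_algebraMap (⟨_, heK 0⟩ : K))
    (by rw [hcancel]; exact isAlgebraic_algebraMap (⟨_, heK 1⟩ : K))

/-- **Card 1's crux-side corollary `royCriterionAt_of_bwCompanion`** (Roy's Conjecture 2 AT `y`,
rank 2, on the companion sector) = the lemma above through the LANDED pointwise transfer
`RoyThesisTyped.le_trdeg_of_royHypothesis`. [cite: Roy2001, Thm. 1] -/
theorem royCriterionAt_of_bwCompanion (y : Fin 2 → ℂ) (hy : LinearIndependent ℚ y) (x₀ : ℂ)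
    (hx₀ : x₀ ∉ Set.range (algebraMap ℚ ℂ))
    (halg : IsAlgebraic ↥(IntermediateField.adjoin ℚ (Set.range y ∪ Set.range (cexp ∘ y))) x₀)
    (h0 : IsAlgebraic ℚ (cexp (x₀ * y 0))) (h1 : IsAlgebraic ℚ (cexp (x₀ * y 1))) :
    ∀ α : Fin 2 → ℂ, (∀ j, α j ≠ 0) → ∀ (s₀ s₁ t₀ t₁ u : ℝ), RoyAdmissible s₀ s₁ t₀ t₁ u →
      RoyHypothesis y α s₀ s₁ t₀ t₁ u →
        (2 : Cardinal) ≤ Algebra.trdeg ℚ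
          ↥(IntermediateField.adjoin ℚ (Set.range y ∪ Set.range α)) :=
  fun _α hα _s₀ _s₁ _t₀ _t₁ _u hadm hhyp =>
    Summit.Schanuel.Schanuel.Theorems.RoyThesisTyped.le_trdeg_of_royHypothesis
      (two_le_trdeg_of_bwCompanion y hy x₀ hx₀ halg h0 h1) hα hadm hhyp

/-- **Card 1's twisted Baker planes** (`two_le_trdeg_twist`): for `ℚ`-linearly independent
logarithms of algebraic numbers `l₀, l₁` and an irrational twist `μ` algebraic over
`K = ℚ(μl₀, μl₁, e^{μl₀}, e^{μl₁})`, Schanuel's inequality holds in rank 2 at `y = (μl₀, μl₁)`: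
`2 ≤ trdeg_ℚ K` — companion `x₀ = μ⁻¹`. Instances: `μ ∈ ℚ̄ ∖ ℚ` ((√2 log 2, √2 log 3)), `μ = l₀`
(((log 2)², log 2·log 3), (−π², πi·log 2)). [cite: BakerTNT1975, Ch. 12 Theorem 12.2] -/
theorem two_le_trdeg_twist (l₀ l₁ μ : ℂ) (hl : LinearIndependent ℚ ![l₀, l₁])
    (he0 : IsAlgebraic ℚ (cexp l₀)) (he1 : IsAlgebraic ℚ (cexp l₁))
    (hμ : μ ∉ Set.range (algebraMap ℚ ℂ))
    (hμalg : IsAlgebraic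
      ↥(IntermediateField.adjoin ℚ (Set.range ![μ * l₀, μ * l₁] ∪
        Set.range (cexp ∘ ![μ * l₀, μ * l₁]))) μ) :
    (2 : Cardinal) ≤ Algebra.trdeg ℚ
      ↥(IntermediateField.adjoin ℚ (Set.range ![μ * l₀, μ * l₁] ∪
        Set.range (cexp ∘ ![μ * l₀, μ * l₁]))) := by
  have hμ0 : μ ≠ 0 := by
    rintro rfl
    exact hμ ⟨0, by simp⟩
  have hli : LinearIndependent ℚ ![μ * l₀, μ * l₁] := by
    rw [LinearIndependent.pair_iff] at hl ⊢
    intro s t hst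
    apply hl s t
    have h' : μ * (s • l₀ + t • l₁) = 0 := by
      simp only [Rat.smul_def] at hst ⊢
      linear_combination hst
    exact (mul_eq_zero.1 h').resolve_left hμ0
  have hμinv : μ⁻¹ ∉ Set.range (algebraMap ℚ ℂ) := by
    rintro ⟨q, hq⟩
    exact hμ ⟨q⁻¹, by rw [map_inv₀, hq, inv_inv]⟩
  refine two_le_trdeg_of_bwCompanion ![μ * l₀, μ * l₁] hli μ⁻¹ hμinv hμalg.inv ?_ ?_
  · simpa [inv_mul_cancel_left₀ hμ0] using he0
  · simpa [inv_mul_cancel_left₀ hμ0] using he1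

/-- **Card 1's named instance `(−π², πi·log 2) = πi • (πi, log 2)`** (log-square twist through
`πi`): `2 ≤ trdeg_ℚ ℚ(−π², πi log 2, e^{−π²}, 2^{πi})`, i.e. at least two of `π, log 2, e^{π²}, 2^{iπ}`
are algebraically independent — kernel-checked from LANDED content only (`two_le_trdeg_twist` above
← `stub_logRichSector`; `ℚ`-independence of `(log 2, πi)` is the landed
`linearIndependent_logTwo_piI`). [cite: BakerTNT1975, Ch. 12 Theorem 12.2] -/
theorem two_le_trdeg_piI_twist_piI_logTwo :
    (2 : Cardinal) ≤ Algebra.trdeg ℚ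
      ↥(IntermediateField.adjoin ℚ
        (Set.range ![(Real.pi : ℂ) * I * ((Real.pi : ℂ) * I), (Real.pi : ℂ) * I * (Real.log 2 : ℂ)] ∪
          Set.range (cexp ∘
            ![(Real.pi : ℂ) * I * ((Real.pi : ℂ) * I), (Real.pi : ℂ) * I * (Real.log 2 : ℂ)]))) := by
  have hl : LinearIndependent ℚ ![(Real.pi : ℂ) * I, (Real.log 2 : ℂ)] :=
    LinearIndependent.pair_symm_iff.1
      Summit.Schanuel.Schanuel.Theorems.linearIndependent_logTwo_piI
  have he0 : IsAlgebraic ℚ (cexp ((Real.pi : ℂ) * I)) := by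
    rw [Complex.exp_pi_mul_I]
    simpa using isAlgebraic_algebraMap (R := ℚ) (A := ℂ) (-1)
  have he1 : IsAlgebraic ℚ (cexp (Real.log 2 : ℂ)) := by
    rw [← Complex.ofReal_exp, Real.exp_log two_pos]
    simpa using isAlgebraic_algebraMap (R := ℚ) (A := ℂ) 2
  have hμ : (Real.pi : ℂ) * I ∉ Set.range (algebraMap ℚ ℂ) := by
    rintro ⟨q, hq⟩
    have him := congrArg Complex.im hq
    simp only [eq_ratCast, Complex.ratCast_im, Complex.mul_im, Complex.ofReal_re, Complex.I_im,
      mul_one, Complex.ofReal_im, Complex.I_re, mul_zero, add_zero] at him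
    exact Real.pi_ne_zero him.symm
  set y : Fin 2 → ℂ :=
    ![(Real.pi : ℂ) * I * ((Real.pi : ℂ) * I), (Real.pi : ℂ) * I * (Real.log 2 : ℂ)] with hy
  set K : IntermediateField ℚ ℂ :=
    IntermediateField.adjoin ℚ (Set.range y ∪ Set.range (cexp ∘ y)) with hK
  have hsq : ((Real.pi : ℂ) * I) ^ 2 ∈ K := by
    rw [sq]
    exact subset_adjoin ℚ _ (Or.inl ⟨0, by simp [hy]⟩)
  have hμalg : IsAlgebraic K ((Real.pi : ℂ) * I) :=
    IsAlgebraic.of_pow two_pos (isAlgebraic_algebraMap (⟨_, hsq⟩ : K))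
  exact two_le_trdeg_twist _ _ _ hl he0 he1 hμ hμalg

/-- Card 1's general grid lemma (`two_le_trdeg_of_grid`, rank-2 case: any `d × ℓ` grid with
`ℓ + d < dℓ` anchored in `K^alg`) IS the landed stub `stub_gridRichSector` (Thm 2.9 `t₂`).
[cite: NesterenkoPhilippon2001, Ch. 14 Theorem 2.9] -/
example :
    ∀ (x : Fin 2 → ℂ) (d l : ℕ) (X : Fin d → ℂ) (Y : Fin l → ℂ), l + d < d * l →
      LinearIndependent ℚ X → LinearIndependent ℚ Y →
      (∀ i, IsAlgebraic ↥(IntermediateField.adjoin ℚ (Set.range x ∪ Set.range (Complex.exp ∘ x))) (X i)) →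
      (∀ j, IsAlgebraic ↥(IntermediateField.adjoin ℚ (Set.range x ∪ Set.range (Complex.exp ∘ x))) (Y j)) →
      (∀ i j, IsAlgebraic ↥(IntermediateField.adjoin ℚ (Set.range x ∪ Set.range (Complex.exp ∘ x)))
        (Complex.exp (X i * Y j))) →
      (2 : Cardinal) ≤ Algebra.trdeg ℚ
        ↥(IntermediateField.adjoin ℚ (Set.range x ∪ Set.range (Complex.exp ∘ x))) :=
  Summit.Schanuel.Schanuel.Theorems.stub_gridRichSector

/-! ### §2 Card `cm-tau-companion-rank-three`: First-lemma block is landed verbatim -/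

/-- Card 2, `three_le_trdeg_SF_of_pi_gamma` = landed `three_le_trdeg_of_pi_gammaQuarter`. -/
example {l : ℕ} (y : Fin l → ℂ) (i j : Fin l) (hi : y i = (Real.pi : ℂ))
    (hj : y j = (Real.Gamma (1 / 4) : ℂ)) :
    (3 : Cardinal) ≤ Algebra.trdeg ℚ
      ↥(IntermediateField.adjoin ℚ (Set.range y ∪ Set.range (cexp ∘ y))) :=
  Summit.Schanuel.Schanuel.Theorems.RoyThesisTyped.three_le_trdeg_of_pi_gammaQuarter y i j hi hj

/-- Card 2, `royCriterionAt_three_of_pi_gamma` (crux format, rank 3) = landed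
`three_le_trdeg_of_royHypothesis_of_pi_gammaQuarter`. -/
example (y : Fin 3 → ℂ) (i j : Fin 3) (hi : y i = (Real.pi : ℂ))
    (hj : y j = (Real.Gamma (1 / 4) : ℂ)) :
    ∀ α : Fin 3 → ℂ, (∀ j, α j ≠ 0) → ∀ (s₀ s₁ t₀ t₁ u : ℝ), RoyAdmissible s₀ s₁ t₀ t₁ u →
      RoyHypothesis y α s₀ s₁ t₀ t₁ u →
        (3 : Cardinal) ≤ Algebra.trdeg ℚ
          ↥(IntermediateField.adjoin ℚ (Set.range y ∪ Set.range α)) :=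
  fun _α hα _s₀ _s₁ _t₀ _t₁ _u hadm hhyp =>
    Summit.Schanuel.Schanuel.Theorems.RoyThesisTyped.three_le_trdeg_of_royHypothesis_of_pi_gammaQuarter
      i j hi hj hα hadm hhyp

/-- Card 2, `linearIndependent_cmGammaTriple` = landed `linearIndependent_piI_pi_gammaQuarter`. -/
example : LinearIndependent ℚ ![(Real.pi : ℂ) * I, (Real.pi : ℂ), (Real.Gamma (1 / 4) : ℂ)] :=
  Summit.Schanuel.Schanuel.Theorems.RoyThesisTyped.linearIndependent_piI_pi_gammaQuarter

/-- Card 2, `royCriterion_iff_forall_at` / `crux_iff_forall_at` = landed `crux_iff_pointwise`. -/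
example : Summit.Schanuel.Schanuel.Theses.RoyCriterion.RoyThesisTyped ↔
      ∀ (l : ℕ) (y : Fin l → ℂ), LinearIndependent ℚ y →
        (l : Cardinal) ≤ Algebra.trdeg ℚ
          ↥(IntermediateField.adjoin ℚ (Set.range y ∪ Set.range (cexp ∘ y))) :=
  Summit.Schanuel.Schanuel.Theorems.RoyThesisTyped.crux_iff_pointwise

end Summit.Schanuel.Schanuel.Cruxes.RoyThesisTyped.TriageR2K1

end

/-! ### §3 (v) Leans-on: the engines exist and are unconditional (axioms printed by the farm) -/
#print axioms Literature.NumberTheory.Transcendental.BrownawellWaldschmidt.brownawell_waldschmidt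
#print axioms Literature.Barriers.Schanuel.two_le_trdeg_gridField₂
#print axioms Literature.Barriers.Schanuel.smallTrdeg_thm_2_9_two_two_holds
#print axioms Literature.NumberTheory.Transcendental.nesterenko_holds
#print axioms Literature.NumberTheory.Transcendental.nesterenko'_holds
#print axioms Literature.NumberTheory.Transcendental.royThm1BtoA_holds
#print axioms Literature.NumberTheory.Transcendental.Roy2001_iff_holds
#print axioms Summit.Schanuel.Schanuel.Theorems.stub_logRichSector
#print axioms Summit.Schanuel.Schanuel.Theorems.stub_gridRichSector
#print axioms Summit.Schanuel.Schanuel.Theorems.RoyThesisTyped.royCriterion_three_on_cmGammaSector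
#print axioms Summit.Schanuel.Schanuel.Theorems.RoyThesisTyped.royCriterion_three_at_lemniscateTriple
#print axioms Summit.Schanuel.Schanuel.Cruxes.RoyThesisTyped.TriageR2K1.two_le_trdeg_of_bwCompanion
#print axioms Summit.Schanuel.Schanuel.Cruxes.RoyThesisTyped.TriageR2K1.royCriterionAt_of_bwCompanion
#print axioms Summit.Schanuel.Schanuel.Cruxes.RoyThesisTyped.TriageR2K1.two_le_trdeg_twist
#print axioms Summit.Schanuel.Schanuel.Cruxes.RoyThesisTyped.TriageR2K1.two_le_trdeg_piI_twist_piI_logTwo
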